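import Mathlib
import Summits.Ventures.PercRepro.TriangleCapRowBandsAll
import Summits.Ventures.PercRepro.TriangleCapBandDistinct

/-!
# PercRepro — THE TOP OF THE CHERRY TABLE OF THE ROW `a` AS A FINSET: `rowBandValues`, ITS MEMBERSHIP AND ITS
CARDINALITY (p3, gen 51; part 250)

`rowBandValues a r T` is the finset of gaps `2 t (r − t − 1) + 2 j` over `t ≤ T` and the truncated band
`2 j + 2 q t ≤ 2 t + t (t − 1) + (a − 1) q (q + 1)`, `q = ⌊t / (a − 1)⌋`.  `cherry_row_gap_set` (the cell hypotheses of
part 249): a gap `g < 2 (T + 1)(r − T − 2)` is attained by a `K₄⁻`-free graph of the cell iff `g ∈ rowBandValues a r T`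
— THE TOP OF THE CHERRY TABLE OF THE ROW `a` IS EXACTLY THIS FINSET; its cardinality is
`Σ_{t ≤ T} (jmax a t + 1)` (`card_rowBandValues`, the values being pairwise distinct by part 248).  Axioms: standard.
-/

namespace PercRepro

namespace TriangleCap

namespace C047

open Finset

/-- The largest `j` of the truncated band `t` of the row `a`: `2 j + 2 q t ≤ 2 t + t (t − 1) + (a − 1) q (q + 1)`. -/
def rowJmax (a t : ℕ) : ℕ := (2 * t + t * (t - 1) + (a - 1) * ((t / (a - 1)) * (t / (a - 1) + 1)) - 2 * (t / (a - 1)) * t) / 2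

/-- The band values of the first `T` layers of the row `a`. -/
def rowBandValues (a r T : ℕ) : Finset ℕ :=
  ((range (T + 1)).sigma (fun t => range (rowJmax a t + 1))).image
    (fun p : Σ _ : ℕ, ℕ => 2 * (p.1 * (r - p.1 - 1)) + 2 * p.2)

/-- The truncated band condition is `j ≤ rowJmax a t` (the right-hand side is even: `2 q t ≤ 2 t + t (t − 1) +
(a − 1) q (q + 1)` and the difference is even, by the tangent-line bound summed over `a − 1` vertices of class `q`). -/
theorem rowJmax_iff (a t j : ℕ) (ht : 1 ≤ t) (ha : 2 ≤ a) :
    2 * j + 2 * (t / (a - 1)) * t ≤ 2 * t + t * (t - 1) + (a - 1) * ((t / (a - 1)) * (t / (a - 1) + 1)) ↔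
      j ≤ rowJmax a t := by
  unfold rowJmax
  have hthr := row_threshold (a - 1) t
  have hcoll := coll_lfRR_zero (a - 1) t (by omega)
  have hle : coll t (lfRR (a - 1) 0) ≤ t * (t - 1) := coll_le t _
  obtain ⟨c, hc⟩ := coll_even t (lfRR (a - 1) 0)
  obtain ⟨d, hd⟩ := Nat.even_mul_pred_self t
  omega

/-- Membership in the row band values. -/
theorem mem_rowBandValues (a r T g : ℕ) :
    g ∈ rowBandValues a r T ↔ ∃ t, t ≤ T ∧ ∃ j, j ≤ rowJmax a t ∧ g = 2 * (t * (r - t - 1)) + 2 * j := by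
  unfold rowBandValues
  simp only [mem_image, mem_sigma, mem_range, Sigma.exists]
  constructor
  · rintro ⟨t, j, ⟨ht, hj⟩, rfl⟩
    exact ⟨t, by omega, j, by omega, rfl⟩
  · rintro ⟨t, ht, j, hj, rfl⟩
    exact ⟨t, j, ⟨by omega, by omega⟩, rfl⟩

/-- `rowJmax a t ≤ t (t + 1) / 2`: the truncated band sits inside the band. -/
theorem two_mul_rowJmax_le (a t : ℕ) (ht : 1 ≤ t) (ha : 2 ≤ a) : 2 * rowJmax a t ≤ t * (t + 1) := by
  have h := (rowJmax_iff a t (rowJmax a t) ht ha).mpr le_rfl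
  unfold rowJmax at h ⊢
  have hthr := row_threshold (a - 1) t
  have hcoll := coll_lfRR_zero (a - 1) t (by omega)
  have hle : coll t (lfRR (a - 1) 0) ≤ t * (t - 1) := coll_le t _
  obtain ⟨d, hd⟩ := Nat.even_mul_pred_self t
  have e : t * (t + 1) = t * (t - 1) + 2 * t := by
    obtain ⟨t', rfl⟩ : ∃ t', t = t' + 1 := ⟨t - 1, by omega⟩
    rw [Nat.add_sub_cancel]
    ring
  omega

/-- **THE TOP OF THE CHERRY TABLE OF THE ROW `a` IS THE FINSET `rowBandValues`** (the hypotheses of part 249): a gap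
`g < 2 (T + 1)(r − T − 2)` is attained by a `K₄⁻`-free graph of the cell iff `g ∈ rowBandValues a r T`. -/
theorem cherry_row_gap_set (k a r T : ℕ) (ha3 : 3 ≤ a) (hr4 : 4 * T + 3 ≤ r)
    (hr : 4 * T + 6 + T * (T + 1) ≤ 2 * r) (hk : 2 * a + r ≤ k) (hk3 : a = 3 → r + 7 ≤ k)
    (hgap : 2 * ((T + 1) * (r - T - 2)) ≤ stabGapFull k a r) (g : ℕ) :
    (g < 2 * ((T + 1) * (r - T - 2)) ∧ ∃ (D : SimpleGraph (Fin k)) (_ : DecidableRel D.Adj), K4mFree D ∧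
        D.edgeFinset.card + r = a * (k - a) ∧
        ∑ v, deg D v * deg D v + r * (k - 1 - r) + g = D.edgeFinset.card * k) ↔
      g ∈ rowBandValues a r T := by
  obtain ⟨h1, h2⟩ := cherry_row_top_layers_all k a r T ha3 hr4 hr hk hk3 hgap
  rw [mem_rowBandValues]
  constructor
  · rintro ⟨hg, D, _, hK, hm, heq⟩
    obtain ⟨t, ht, j, hj, hjq, h⟩ := h1 D hK hm (by omega)
    refine ⟨t, ht, j, ?_, by omega⟩
    rcases Nat.eq_zero_or_pos t with rfl | hpos
    · have : j = 0 := by omega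
      subst this
      exact Nat.zero_le _
    · exact (rowJmax_iff a t j hpos (by omega)).mp hjq
  · rintro ⟨t, ht, j, hj, rfl⟩
    have hjq : 2 * j + 2 * (t / (a - 1)) * t ≤ 2 * t + t * (t - 1) + (a - 1) * ((t / (a - 1)) * (t / (a - 1) + 1)) := by
      rcases Nat.eq_zero_or_pos t with rfl | hpos
      · unfold rowJmax at hj
        simp at hj
        omega
      · exact (rowJmax_iff a t j hpos (by omega)).mpr hj
    have hj2 : 2 * j ≤ t * (t + 1) := by
      rcases Nat.eq_zero_or_pos t with rfl | hpos
      · unfold rowJmax at hj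
        simp at hj
        omega
      · have := two_mul_rowJmax_le a t hpos (by omega)
        omega
    refine ⟨band_lt_tail r T t j ht hr hj2, h2 t ht j hj2 hjq⟩

/-- **THE NUMBER OF VALUES OF THE FIRST `T` LAYERS OF THE ROW `a`** (`2 ≤ a`, `2 r ≥ 4 T + 6 + T (T + 1)`):
`#(rowBandValues a r T) = Σ_{t ≤ T} (rowJmax a t + 1)`. -/
theorem card_rowBandValues (a r T : ℕ) (ha : 2 ≤ a) (hT : 4 * T + 6 + T * (T + 1) ≤ 2 * r) :
    (rowBandValues a r T).card = ∑ t ∈ range (T + 1), (rowJmax a t + 1) := by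
  unfold rowBandValues
  rw [card_image_of_injOn, card_sigma]
  · apply sum_congr rfl
    intro t _
    rw [card_range]
  · intro p hp p' hp' h
    simp only [coe_sigma, Set.mem_sigma_iff, coe_range, Set.mem_Iio] at hp hp'
    have hj : 2 * p.2 ≤ p.1 * (p.1 + 1) := by
      rcases Nat.eq_zero_or_pos p.1 with h0 | hpos
      · rw [h0] at hp ⊢
        unfold rowJmax at hp
        simp at hp
        omega
      · have := two_mul_rowJmax_le a p.1 hpos ha
        omega
    have hj' : 2 * p'.2 ≤ p'.1 * (p'.1 + 1) := by
      rcases Nat.eq_zero_or_pos p'.1 with h0 | hpos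
      · rw [h0] at hp' ⊢
        unfold rowJmax at hp'
        simp at hp'
        omega
      · have := two_mul_rowJmax_le a p'.1 hpos ha
        omega
    obtain ⟨h1, h2⟩ := band_value_injective r T p.1 p'.1 p.2 p'.2 hT (by omega) (by omega) hj hj' h
    exact Sigma.ext h1 (heq_of_eq h2)

end C047

end TriangleCap

end PercRepro
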